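import Summits.AnomalousDissipation.AnomalousDissipation.Theorems.SolenoidalFractalHomogenisationRealisedQuasiStaticCellLawIsoSectorDecayRates
import Summits.AnomalousDissipation.AnomalousDissipation.Theorems.SolenoidalFractalHomogenisationRealisedQuasiStaticCellLawIsotropicStretch
import Summits.AnomalousDissipation.AnomalousDissipation.Theorems.SolenoidalFractalHomogenisationRealisedQuasiStaticCellLawIsoEndScalars
import Summits.AnomalousDissipation.AnomalousDissipation.Theorems.SolenoidalFractalHomogenisationRealisedQuasiStaticCellLawWeakFarSlotAlgebra
import Summits.AnomalousDissipation.AnomalousDissipation.Theorems.SolenoidalFractalHomogenisationRealisedQuasiStaticCellLawWeakNearSlotScalars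
import Summits.AnomalousDissipation.AnomalousDissipation.Theorems.SolenoidalFractalHomogenisationRealisedQuasiStaticCellLawWeakNearGlobal
import Summits.AnomalousDissipation.AnomalousDissipation.Theorems.SolenoidalFractalHomogenisationRealisedQuasiStaticCellLawCellSlotFormulas
import HarnessLib

/-!
# K2R `RealisedQuasiStaticCellLaw`, line `floquet-bloch`, stub `stub_lowSectorWeakNear`: the W-near road at the replayed cell
# word (helper; `--supports stmt-AnomalousDissipation-20446`)

Summits-side helper file (everything proved; no definitions, no named facts). `isoSector_decay_of_rates` (p595074) instantiated
at `W′ = (cubatureWord.stretch M).stretch (1/ν)` (isotropic with constant `c0`, `isotropicWordGain_cellWord`), `κ = ν/n²`,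
`ε = δ/8`, `β = 2·10⁵/δ`, `λP′ = (1 − δ/50)·MU` for a sector representative `ℓ` with `1 ≤ |ℓ|² ≤ 3` and
`‖ℓ‖ ≤ (δ/10⁴)·nν`: in the regime `M ≥ 400/δ`, `ν ≤ 10⁻³`, `10⁵(M+1)/δ ≤ nν` the seven scalar hypotheses hold
(`near_hsmall/hβ'/hJ/hF`, `near_global`, closed forms of the slot sums) and the decay is at least the crux target rate
`8π²(1 + (1−δ)c_W/ν²)ν/n²` with prefactor `(10⁵(M+1)/δ)/ν` (`weakNear_decay_at_cell`).
-/

set_option linter.dupNamespace false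

noncomputable section

namespace Summit.AnomalousDissipation.AnomalousDissipation.Theorems.SolenoidalFractalHomogenisation.RealisedQuasiStaticCellLaw

open Set MeasureTheory Filter Topology Function Matrix
open scoped InnerProductSpace ComplexConjugate Matrix
open Literature.Analysis Literature.Analysis.FunctionSpaces Literature.Analysis.FunctionSpaces.Torus
open Literature.Analysis.FluidPDE Literature.Analysis.FluidPDE.LatticeShear

set_option maxHeartbeats 1600000 in
/-- **The W-near road at the cell word.** -/
theorem weakNear_decay_at_cell {δ M ν : ℝ} (hδ : 0 < δ) (hδ1 : δ ≤ 1) (hM : 0 < M) (hMδ : 400 / δ ≤ M)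
    (hν : 0 < ν) (hν1 : ν ≤ 1 / 1000) {n : ℕ} (hKn : 100000 * (M + 1) / δ ≤ (n : ℝ) * ν)
    (ℓ : Fin 3 → ℤ) (hℓ : ℓ ≠ 0) (hℓ3 : freqNormSq ℓ ≤ 3)
    (hsmall : ‖latticeVec ℓ‖ ≤ δ / 10000 * ((n : ℝ) * ν))
    {w₀ : UnitAddTorus (Fin 3) → EuclideanSpace ℝ (Fin 3)}
    (hw₀ : FunctionSpaces.Torus.MemSobolev 1 (FunctionSpaces.EuclideanSpace.complexify ∘ w₀))
    (hdiv : FunctionSpaces.Torus.IsWeaklyDivFree w₀) (hmean : FunctionSpaces.Torus.HasZeroMean w₀)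
    (hsupp : ∀ k : Fin 3 → ℤ, ¬ ((∃ z : Fin 3 → ℤ, k = ℓ + (n:ℤ) • z) ∨ (∃ z : Fin 3 → ℤ, k = -ℓ + (n:ℤ) • z)) →
      UnitAddTorus.mFourierCoeff (FunctionSpaces.EuclideanSpace.complexify ∘ w₀) k = 0)
    {T : ℝ} (hT : 0 < T) {w : ℝ → UnitAddTorus (Fin 3) → EuclideanSpace ℝ (Fin 3)}
    (hw : Torus.IsWeakPassiveVectorOn 0 T (ν / (n : ℝ) ^ 2)
      (((cubatureWord.stretch M hM).stretch (1 / ν) (one_div_pos.mpr hν)).cell n) w₀ w) :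
    ∀ᵐ t ∂(volume.restrict (Ioo 0 T)), ∫ x, ‖w t x‖ ^ 2 ≤
      (100000 * (M + 1) / δ / ν) *
        Real.exp (-(8 * Real.pi ^ 2 * (1 + (1 - δ) * ((1 - 4 * cubatureWord.ramp / 3) * c0) / ν ^ 2) * ν /
          (n : ℝ) ^ 2) * t) * ∫ x, ‖w₀ x‖ ^ 2 := by
  classical
  obtain ⟨W', hW'⟩ : ∃ W' : LatticeWord 26, W' = (cubatureWord.stretch M hM).stretch (1 / ν) (one_div_pos.mpr hν) :=
    ⟨_, rfl⟩
  have hWiso : IsotropicWordGain W' c0 := by rw [hW']; exact isotropicWordGain_cellWord hM _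
  rw [← hW'] at hw
  have hπ := Real.pi_gt_three
  have hc0p := c0_pos
  have hρ : cubatureWord.ramp = 1 / 2 := (cubature_phase_fields 0).2.2.2
  have hcc : c0 = 7 / (4960 * Real.pi ^ 4) := rfl
  have hr3 : (1 - 4 * (1 / 2 : ℝ) / 3) = 1 / 3 := by norm_num
  -- the regime
  have hδM : 400 ≤ δ * M := by rwa [div_le_iff₀' hδ] at hMδ
  have hM400 : 400 ≤ M := by nlinarith [hδM, hδ1, hM]
  have hKn' : 100000 * (M + 1) ≤ δ * ((n : ℝ) * ν) := by
    have h := hKn; rw [div_le_iff₀ hδ] at h; linarith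
  have hnν : 300 ≤ (n : ℝ) * ν := by nlinarith
  have hn : 0 < n := Nat.pos_of_ne_zero (by rintro rfl; norm_num at hnν)
  have hn' : (0 : ℝ) < n := by exact_mod_cast hn
  have hκ : 0 < ν / (n : ℝ) ^ 2 := by positivity
  -- the slot constants of `W'`
  have hcs := fun j => cellSlot_formulas cubatureWord hM hν hn j ℓ
  have hfm : ∀ j, (W'.phase j).m = (cubatureWord.phase j).m := fun j => by rw [hW']; exact (hcs j).1
  have hfe : ∀ j, (W'.phase j).e = (cubatureWord.phase j).e := fun j => by rw [hW']; exact (hcs j).2.1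
  have hfφ : ∀ j, (W'.phase j).φ = (cubatureWord.phase j).φ := fun j => by rw [hW']; exact (hcs j).2.2.1
  have hfτ : ∀ j, (W'.phase j).τ = M * (cubatureWord.phase j).τ / ν := fun j => by
    rw [hW']; exact (hcs j).2.2.2.1
  have hframp : W'.ramp = cubatureWord.ramp := by rw [hW']; exact (hcs 0).2.2.2.2.1
  have hfP : W'.period = M * 3720 / ν := by rw [hW', (hcs 0).2.2.2.2.2.1, period_cubatureWord]
  have hΛ := fun j => (hcs j).2.2.2.2.2.2.1
  have hg := fun j => (hcs j).2.2.2.2.2.2.2.2.1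
  clear hcs
  have hslot := fun j => cubature_slot_bounds j
  -- sector data
  have ha1 : 1 ≤ ‖latticeVec ℓ‖ := one_le_norm_latticeVec hℓ
  have ha0 : 0 < ‖latticeVec ℓ‖ := by linarith
  have hA : freqNormSq ℓ = ‖latticeVec ℓ‖ ^ 2 := (norm_latticeVec_sq ℓ).symm
  have hA1 : 1 ≤ freqNormSq ℓ := by rw [hA]; nlinarith
  have han : 10000 * ‖latticeVec ℓ‖ ≤ δ * ((n : ℝ) * ν) := by linarith
  have han1 : 10000 * ‖latticeVec ℓ‖ ≤ (n : ℝ) * ν := by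
    have : δ * ((n : ℝ) * ν) ≤ (n : ℝ) * ν := by nlinarith
    linarith
  have hℓn : 2 * ‖latticeVec ℓ‖ ≤ n := by
    have : (n : ℝ) * ν ≤ n := by nlinarith
    linarith
  have h4 : ∀ j : Fin 26, 4 * ‖latticeVec ℓ‖ ≤ ‖latticeVec (fun i => (W'.phase j).m i * (n : ℤ))‖ := by
    intro j
    rw [hfm j, (dot_cast_cellFreq ℓ _ n).2]
    have := (hslot j).2.2.2.1
    have : (n : ℝ) * ν ≤ n := by nlinarith
    nlinarith
  have hQ : (latticeVec ℓ) 0 ^ 2 + (latticeVec ℓ) 1 ^ 2 + (latticeVec ℓ) 2 ^ 2 = freqNormSq ℓ := by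
    rw [(freqNormSq_coords ℓ).1]; simp only [latticeVec_apply]
  -- per-slot identities at the cell
  have id1 : ∀ j : Fin 26, 4 * Real.pi ^ 2 * freqNormSq (cubatureWord.phase j).m * ν *
      (freqNormSq ℓ / freqNormSq (fun i => (cubatureWord.phase j).m i * (n : ℤ))) * (M * (cubatureWord.phase j).τ / ν) =
      4 * Real.pi ^ 2 * M * freqNormSq ℓ / (n : ℝ) ^ 2 * (cubatureWord.phase j).τ := by
    intro j
    have hF := (hslot j).1
    rw [freqNormSq_cellFreq]
    field_simp
  have id2 : ∀ j : Fin 26, 4 * Real.pi ^ 2 * freqNormSq (cubatureWord.phase j).m * ν *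
      (M * (cubatureWord.phase j).τ / ν) *
      ((∑ i, (cubatureWord.phase j).e i * (ℓ i : ℝ)) /
        (8 * Real.pi ^ 2 * freqNormSq (cubatureWord.phase j).m * ‖latticeVec (cubatureWord.phase j).m‖ * n * ν)) ^ 2 =
      2 * Real.pi ^ 2 * M / (ν ^ 2 * (n : ℝ) ^ 2) * slotTerm (slots j) (latticeVec ℓ) 0 := by
    intro j
    obtain ⟨hF1, -, hbmF, hbm1, -⟩ := hslot j
    rw [← cubature_coupling_sq j ℓ, ← hbmF]
    have : 0 < ‖latticeVec (cubatureWord.phase j).m‖ := by linarith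
    field_simp
    ring
  have hτsum : ∑ j, (cubatureWord.phase j).τ = 3720 := period_cubatureWord
  have hS0 : ∑ j, slotTerm (slots j) (latticeVec ℓ) 0 = 280 * freqNormSq ℓ / (32 * Real.pi ^ 4) := by
    rw [slotTerm_sum, hQ]
    simp only [PiLp.zero_apply]
    ring
  have sum1 : ∑ j : Fin 26, 4 * Real.pi ^ 2 * freqNormSq (cubatureWord.phase j).m * ν *
      (freqNormSq ℓ / freqNormSq (fun i => (cubatureWord.phase j).m i * (n : ℤ))) * (M * (cubatureWord.phase j).τ / ν) =
      4 * Real.pi ^ 2 * M * freqNormSq ℓ / (n : ℝ) ^ 2 * 3720 := by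
    rw [Finset.sum_congr rfl (fun j _ => id1 j), ← Finset.mul_sum, hτsum]
  have sum2 : ∑ j : Fin 26, 4 * Real.pi ^ 2 * freqNormSq (cubatureWord.phase j).m * ν *
      (M * (cubatureWord.phase j).τ / ν) *
      ((∑ i, (cubatureWord.phase j).e i * (ℓ i : ℝ)) /
        (8 * Real.pi ^ 2 * freqNormSq (cubatureWord.phase j).m * ‖latticeVec (cubatureWord.phase j).m‖ * n * ν)) ^ 2 =
      2 * Real.pi ^ 2 * M / (ν ^ 2 * (n : ℝ) ^ 2) * (280 * freqNormSq ℓ / (32 * Real.pi ^ 4)) := by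
    rw [Finset.sum_congr rfl (fun j _ => id2 j), ← Finset.mul_sum, hS0]
  -- the slot exponents `Y_j`
  have idY : ∀ j : Fin 26, 4 * Real.pi ^ 2 * freqNormSq (cubatureWord.phase j).m * ν *
      ((freqNormSq ℓ / freqNormSq (fun i => (cubatureWord.phase j).m i * (n : ℤ))) * (M * (cubatureWord.phase j).τ / ν) +
        32 / 7 * ((∑ i, (cubatureWord.phase j).e i * (ℓ i : ℝ)) /
          (8 * Real.pi ^ 2 * freqNormSq (cubatureWord.phase j).m * ‖latticeVec (cubatureWord.phase j).m‖ * n * ν)) ^ 2 *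
          (M * (cubatureWord.phase j).τ / ν * (1 / 3))) +
      4 * Real.pi ^ 2 * freqNormSq (cubatureWord.phase j).m * ν *
      ((freqNormSq ℓ / freqNormSq (fun i => (cubatureWord.phase j).m i * (n : ℤ))) * (M * (cubatureWord.phase j).τ / ν) +
        32 / 7 * ((∑ i, (cubatureWord.phase j).e i * (ℓ i : ℝ)) /
          (8 * Real.pi ^ 2 * freqNormSq (cubatureWord.phase j).m * ‖latticeVec (cubatureWord.phase j).m‖ * n * ν)) ^ 2 *
          (M * (cubatureWord.phase j).τ / ν * (1 / 3))) =
      2 * (4 * Real.pi ^ 2 * M * freqNormSq ℓ / (n : ℝ) ^ 2 * (cubatureWord.phase j).τ) +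
        64 / 21 * (2 * Real.pi ^ 2 * M / (ν ^ 2 * (n : ℝ) ^ 2) * slotTerm (slots j) (latticeVec ℓ) 0) := by
    intro j
    linear_combination 2 * id1 j + 64 / 21 * id2 j
  have sumY : ∑ j : Fin 26, (4 * Real.pi ^ 2 * freqNormSq (cubatureWord.phase j).m * ν *
      ((freqNormSq ℓ / freqNormSq (fun i => (cubatureWord.phase j).m i * (n : ℤ))) * (M * (cubatureWord.phase j).τ / ν) +
        32 / 7 * ((∑ i, (cubatureWord.phase j).e i * (ℓ i : ℝ)) /
          (8 * Real.pi ^ 2 * freqNormSq (cubatureWord.phase j).m * ‖latticeVec (cubatureWord.phase j).m‖ * n * ν)) ^ 2 *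
          (M * (cubatureWord.phase j).τ / ν * (1 / 3))) +
      4 * Real.pi ^ 2 * freqNormSq (cubatureWord.phase j).m * ν *
      ((freqNormSq ℓ / freqNormSq (fun i => (cubatureWord.phase j).m i * (n : ℤ))) * (M * (cubatureWord.phase j).τ / ν) +
        32 / 7 * ((∑ i, (cubatureWord.phase j).e i * (ℓ i : ℝ)) /
          (8 * Real.pi ^ 2 * freqNormSq (cubatureWord.phase j).m * ‖latticeVec (cubatureWord.phase j).m‖ * n * ν)) ^ 2 *
          (M * (cubatureWord.phase j).τ / ν * (1 / 3)))) =
      freqNormSq ℓ * (2 * (4 * Real.pi ^ 2 * 3720 * M / (n : ℝ) ^ 2) + 160 / 21 * (7 * M / (Real.pi ^ 2 * (n : ℝ) ^ 2 * ν ^ 2))) := by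
    rw [Finset.sum_congr rfl (fun j _ => idY j), Finset.sum_add_distrib, ← Finset.mul_sum, ← Finset.mul_sum,
      ← Finset.mul_sum, ← Finset.mul_sum, hτsum, hS0]
    field_simp
    ring
  have hY0 : ∀ j : Fin 26, 0 ≤ 4 * Real.pi ^ 2 * freqNormSq (cubatureWord.phase j).m * ν *
      ((freqNormSq ℓ / freqNormSq (fun i => (cubatureWord.phase j).m i * (n : ℤ))) * (M * (cubatureWord.phase j).τ / ν) +
        32 / 7 * ((∑ i, (cubatureWord.phase j).e i * (ℓ i : ℝ)) /
          (8 * Real.pi ^ 2 * freqNormSq (cubatureWord.phase j).m * ‖latticeVec (cubatureWord.phase j).m‖ * n * ν)) ^ 2 *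
          (M * (cubatureWord.phase j).τ / ν * (1 / 3))) +
      4 * Real.pi ^ 2 * freqNormSq (cubatureWord.phase j).m * ν *
      ((freqNormSq ℓ / freqNormSq (fun i => (cubatureWord.phase j).m i * (n : ℤ))) * (M * (cubatureWord.phase j).τ / ν) +
        32 / 7 * ((∑ i, (cubatureWord.phase j).e i * (ℓ i : ℝ)) /
          (8 * Real.pi ^ 2 * freqNormSq (cubatureWord.phase j).m * ‖latticeVec (cubatureWord.phase j).m‖ * n * ν)) ^ 2 *
          (M * (cubatureWord.phase j).τ / ν * (1 / 3))) := by
    intro j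
    have := (cubatureWord.phase j).τ_pos
    have := freqNormSq_nonneg ℓ
    have := freqNormSq_nonneg (fun i => (cubatureWord.phase j).m i * (n : ℤ))
    have hF0 : 0 < freqNormSq (cubatureWord.phase j).m := by linarith [(hslot j).1]
    positivity
  -- the global bookkeeping
  have hng := near_global (M := M) (n := (n : ℝ)) hA1 hℓ3 hA (norm_nonneg _) han hδ hδ1 hν hν1 hM400 hn' hKn hcc
  dsimp only at hng
  obtain ⟨hMU0, hMUle, hSY0, hSYle, hx0, hx1, hbudget, hlamν, hlamlo, hrate, hpref⟩ := hng
  -- MU in closed form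
  have hMUeq : (∑ j : Fin 26, 4 * Real.pi ^ 2 * freqNormSq (cubatureWord.phase j).m * ν *
      (freqNormSq ℓ / freqNormSq (fun i => (cubatureWord.phase j).m i * (n : ℤ))) * (M * (cubatureWord.phase j).τ / ν)) +
      1 / 3 * 1 * (2 * (2 * Real.pi ^ 2 / (ν / (n : ℝ) ^ 2 * (n : ℝ) ^ 4) * (c0 * (M * 3720 / ν) * ‖latticeVec ℓ‖ ^ 2)) -
        12 * ‖latticeVec ℓ‖ / (n : ℝ) * ∑ j : Fin 26, 4 * Real.pi ^ 2 * freqNormSq (cubatureWord.phase j).m * ν *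
          (M * (cubatureWord.phase j).τ / ν) *
          ((∑ i, (cubatureWord.phase j).e i * (ℓ i : ℝ)) /
            (8 * Real.pi ^ 2 * freqNormSq (cubatureWord.phase j).m * ‖latticeVec (cubatureWord.phase j).m‖ * n * ν)) ^ 2) =
      freqNormSq ℓ * (4 * Real.pi ^ 2 * 3720 * M / (n : ℝ) ^ 2 +
        7 * M / (Real.pi ^ 2 * (n : ℝ) ^ 2 * ν ^ 2) * (1 - 10 * ‖latticeVec ℓ‖ / (n : ℝ))) := by
    rw [sum1, sum2, hcc, ← hA]
    field_simp
    ring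
  -- the free rate
  obtain ⟨lam, hlam⟩ : ∃ lam : ℝ, lam = (1 - δ / 50) * (freqNormSq ℓ * (4 * Real.pi ^ 2 * 3720 * M / (n : ℝ) ^ 2 +
      7 * M / (Real.pi ^ 2 * (n : ℝ) ^ 2 * ν ^ 2) * (1 - 10 * ‖latticeVec ℓ‖ / (n : ℝ)))) * ν / (M * 3720) := ⟨_, rfl⟩
  have hlam0 : 0 ≤ lam := by rw [hlam]; exact div_nonneg (mul_nonneg hx0 hν.le) (by positivity)
  have hxlam : lam * (M * 3720 / ν) = (1 - δ / 50) * (freqNormSq ℓ * (4 * Real.pi ^ 2 * 3720 * M / (n : ℝ) ^ 2 +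
      7 * M / (Real.pi ^ 2 * (n : ℝ) ^ 2 * ν ^ 2) * (1 - 10 * ‖latticeVec ℓ‖ / (n : ℝ)))) := by
    rw [hlam]; field_simp
  rw [← hlam] at hlamν hlamlo hrate hpref
  have hx1' : lam * (M * 3720 / ν) ≤ 1 / 100 := by rw [hxlam]; exact hx1
  -- the main estimate
  have main := isoSector_decay_of_rates W' hWiso hn hκ ℓ hℓ hℓn hw₀ hdiv hmean hsupp h4 (ε := δ / 8) (β := 200000 / δ)
    (lam := lam) (by positivity) (by linarith) (by rw [le_div_iff₀ hδ]; linarith) hlam0 ?_ ?_ ?_ ?_ ?_ ?_ ?_ hT hw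
  rotate_left
  · -- hsmall
    intro j
    rw [hfm j, hfe j, hfφ j, hg j, hΛ j]
    exact near_hsmall (coupling_abs_le _ ℓ) (hslot j).1 (hslot j).2.2.2.1 hn' hν han1 hlam0 hlamν
  · -- hβ'
    intro j
    rw [hframp, hfP, hρ, hr3]
    simp only [hfm, hfe, hfφ, hfτ]
    simp only [hg]
    simp only [hΛ]
    rw [sumY]
    have hΞ : Real.exp (4 * (freqNormSq ℓ * (2 * (4 * Real.pi ^ 2 * 3720 * M / (n : ℝ) ^ 2) +
        160 / 21 * (7 * M / (Real.pi ^ 2 * (n : ℝ) ^ 2 * ν ^ 2))))) ≤ 6 / 5 := by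
      have h0 : 0 ≤ 4 * (freqNormSq ℓ * (2 * (4 * Real.pi ^ 2 * 3720 * M / (n : ℝ) ^ 2) +
          160 / 21 * (7 * M / (Real.pi ^ 2 * (n : ℝ) ^ 2 * ν ^ 2)))) := by linarith [hSY0]
      have h1 : |4 * (freqNormSq ℓ * (2 * (4 * Real.pi ^ 2 * 3720 * M / (n : ℝ) ^ 2) +
          160 / 21 * (7 * M / (Real.pi ^ 2 * (n : ℝ) ^ 2 * ν ^ 2))))| ≤ 1 := by
        rw [abs_of_nonneg h0]; linarith
      have h2 := Real.abs_exp_sub_one_le h1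
      rw [abs_of_nonneg h0] at h2
      have h3 := le_trans (le_abs_self _) h2
      linarith
    exact near_hβ' (coupling_abs_le _ ℓ) (hslot j).1 (hslot j).2.2.2.1 hν hn' hδ hlam0 hx1' hlamlo
      (Real.exp_pos _).le hΞ
  · -- hJ
    intro j
    rw [hframp, hfP, hfm j, hfe j, hfφ j, hfτ j, hg j, hΛ j]
    exact near_hJ (coupling_abs_le _ ℓ) (hslot j).1 (hslot j).2.2.2.1 (hslot j).2.2.2.2 hM hν hn' hδ hδ1 hδM han hlam0
      hx1' hlamlo hρ
  · -- hF
    intro j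
    rw [hfτ j]
    exact near_hF hδ.le hlam0 hlamν hM (cubatureWord.phase j).τ_pos hν hn'
  · -- hSY
    rw [hframp, hρ, hr3]
    simp only [hfm, hfe, hfφ, hfτ]
    simp only [hg]
    simp only [hΛ]
    have h := sum_exp_sub_one_le_two_mul Finset.univ _ (fun j _ => hY0 j) (by rw [sumY]; linarith)
    rw [sumY] at h
    linarith
  · -- hposY
    rw [hframp, hfP, hρ, hr3]
    simp only [hfm, hfe, hfφ, hfτ]
    simp only [hg]
    simp only [hΛ]
    rw [hMUeq]
    have hS1 : (∑ j : Fin 26, (Real.exp (4 * Real.pi ^ 2 * freqNormSq (cubatureWord.phase j).m * ν *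
      ((freqNormSq ℓ / freqNormSq (fun i => (cubatureWord.phase j).m i * (n : ℤ))) * (M * (cubatureWord.phase j).τ / ν) +
        32 / 7 * ((∑ i, (cubatureWord.phase j).e i * (ℓ i : ℝ)) /
          (8 * Real.pi ^ 2 * freqNormSq (cubatureWord.phase j).m * ‖latticeVec (cubatureWord.phase j).m‖ * n * ν)) ^ 2 *
          (M * (cubatureWord.phase j).τ / ν * (1 / 3))) +
      4 * Real.pi ^ 2 * freqNormSq (cubatureWord.phase j).m * ν *
      ((freqNormSq ℓ / freqNormSq (fun i => (cubatureWord.phase j).m i * (n : ℤ))) * (M * (cubatureWord.phase j).τ / ν) +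
        32 / 7 * ((∑ i, (cubatureWord.phase j).e i * (ℓ i : ℝ)) /
          (8 * Real.pi ^ 2 * freqNormSq (cubatureWord.phase j).m * ‖latticeVec (cubatureWord.phase j).m‖ * n * ν)) ^ 2 *
          (M * (cubatureWord.phase j).τ / ν * (1 / 3)))) - 1)) ≤ 1 := by
      have h := sum_exp_sub_one_le_two_mul Finset.univ _ (fun j _ => hY0 j) (by rw [sumY]; linarith)
      rw [sumY] at h; linarith
    have hS0' : 0 ≤ (∑ j : Fin 26, (Real.exp (4 * Real.pi ^ 2 * freqNormSq (cubatureWord.phase j).m * ν *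
      ((freqNormSq ℓ / freqNormSq (fun i => (cubatureWord.phase j).m i * (n : ℤ))) * (M * (cubatureWord.phase j).τ / ν) +
        32 / 7 * ((∑ i, (cubatureWord.phase j).e i * (ℓ i : ℝ)) /
          (8 * Real.pi ^ 2 * freqNormSq (cubatureWord.phase j).m * ‖latticeVec (cubatureWord.phase j).m‖ * n * ν)) ^ 2 *
          (M * (cubatureWord.phase j).τ / ν * (1 / 3))) +
      4 * Real.pi ^ 2 * freqNormSq (cubatureWord.phase j).m * ν *
      ((freqNormSq ℓ / freqNormSq (fun i => (cubatureWord.phase j).m i * (n : ℤ))) * (M * (cubatureWord.phase j).τ / ν) +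
        32 / 7 * ((∑ i, (cubatureWord.phase j).e i * (ℓ i : ℝ)) /
          (8 * Real.pi ^ 2 * freqNormSq (cubatureWord.phase j).m * ‖latticeVec (cubatureWord.phase j).m‖ * n * ν)) ^ 2 *
          (M * (cubatureWord.phase j).τ / ν * (1 / 3)))) - 1)) :=
      Finset.sum_nonneg fun j _ => by linarith [Real.add_one_le_exp (4 * Real.pi ^ 2 * freqNormSq (cubatureWord.phase j).m * ν *
      ((freqNormSq ℓ / freqNormSq (fun i => (cubatureWord.phase j).m i * (n : ℤ))) * (M * (cubatureWord.phase j).τ / ν) +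
        32 / 7 * ((∑ i, (cubatureWord.phase j).e i * (ℓ i : ℝ)) /
          (8 * Real.pi ^ 2 * freqNormSq (cubatureWord.phase j).m * ‖latticeVec (cubatureWord.phase j).m‖ * n * ν)) ^ 2 *
          (M * (cubatureWord.phase j).τ / ν * (1 / 3))) +
      4 * Real.pi ^ 2 * freqNormSq (cubatureWord.phase j).m * ν *
      ((freqNormSq ℓ / freqNormSq (fun i => (cubatureWord.phase j).m i * (n : ℤ))) * (M * (cubatureWord.phase j).τ / ν) +
        32 / 7 * ((∑ i, (cubatureWord.phase j).e i * (ℓ i : ℝ)) /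
          (8 * Real.pi ^ 2 * freqNormSq (cubatureWord.phase j).m * ‖latticeVec (cubatureWord.phase j).m‖ * n * ν)) ^ 2 *
          (M * (cubatureWord.phase j).τ / ν * (1 / 3)))), hY0 j]
    nlinarith [hMU0, hS1, hS0']
  · -- hlamY
    rw [hframp, hfP, hρ, hr3]
    simp only [hfm, hfe, hfφ, hfτ]
    simp only [hg]
    simp only [hΛ]
    rw [hMUeq, show 2 * lam * (M * 3720 / ν) = 2 * (lam * (M * 3720 / ν)) by ring, hxlam]
    refine exp_two_mul_le_transport_sq hx0 (by linarith) (hbudget _ ?_ ?_)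
    · exact Finset.sum_nonneg fun j _ => by linarith [Real.add_one_le_exp (4 * Real.pi ^ 2 * freqNormSq (cubatureWord.phase j).m * ν *
      ((freqNormSq ℓ / freqNormSq (fun i => (cubatureWord.phase j).m i * (n : ℤ))) * (M * (cubatureWord.phase j).τ / ν) +
        32 / 7 * ((∑ i, (cubatureWord.phase j).e i * (ℓ i : ℝ)) /
          (8 * Real.pi ^ 2 * freqNormSq (cubatureWord.phase j).m * ‖latticeVec (cubatureWord.phase j).m‖ * n * ν)) ^ 2 *
          (M * (cubatureWord.phase j).τ / ν * (1 / 3))) +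
      4 * Real.pi ^ 2 * freqNormSq (cubatureWord.phase j).m * ν *
      ((freqNormSq ℓ / freqNormSq (fun i => (cubatureWord.phase j).m i * (n : ℤ))) * (M * (cubatureWord.phase j).τ / ν) +
        32 / 7 * ((∑ i, (cubatureWord.phase j).e i * (ℓ i : ℝ)) /
          (8 * Real.pi ^ 2 * freqNormSq (cubatureWord.phase j).m * ‖latticeVec (cubatureWord.phase j).m‖ * n * ν)) ^ 2 *
          (M * (cubatureWord.phase j).τ / ν * (1 / 3)))), hY0 j]
    · have h := sum_exp_sub_one_le_two_mul Finset.univ _ (fun j _ => hY0 j) (by rw [sumY]; linarith)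
      rw [sumY] at h; exact h
  -- prefactor and rate
  rw [hfP] at main
  have hX : 0 ≤ ∫ x, ‖w₀ x‖ ^ 2 := integral_nonneg fun x => by positivity
  have hK0 : 0 ≤ 100000 * (M + 1) / δ / ν := by positivity
  rw [hρ]
  filter_upwards [main, ae_restrict_mem measurableSet_Ioo] with t ht htI
  refine ht.trans ?_
  exact decay_form_mono hpref hK0 hrate htI.1.le hX

end Summit.AnomalousDissipation.AnomalousDissipation.Theorems.SolenoidalFractalHomogenisation.RealisedQuasiStaticCellLaw

end
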